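import Literature.AnabelianGeometry.AbsoluteAnabelian.NeukirchUchidaTransportGamma
import Literature.AnabelianGeometry.AbsoluteAnabelian.NFDecompositionNestedProofs
import Literature.NumberTheory.GaloisRepresentations.ValuationSubringOverAbsPrime
import Literature.NumberTheory.GaloisRepresentations.NeukirchAbstractExistence
import Literature.GroupTheory.LocallyConstantCochainTransport
import HarnessLib

/-!
# Base change of explicit cochains from `Gal(\bar ℚ/ℚ)` to a number field `K ⊆ \bar ℚ`

Topic `NumberTheory/GaloisRepresentations`; namespace
`Literature.NumberTheory.GaloisRepresentations.ExplicitMuCocycles` (plus two transport lemmas in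
`Literature.GroupTheory.LocallyConstantCocycles`).  Proof file: theorems only (no definition, no
instance, no named fact).

SETTING ([NeukirchSchmidtWingberg2008] XII §1, proof of (12.1.9); [Neukirch1969] §2).  `Γ = Gal(Ω/ℚ)`
(`absoluteGaloisGroup ℚ`, `Ω = AlgebraicClosure ℚ`) acts on the nonarchimedean primes of `Ω`
(valuation subrings `A ≠ ⊤`, stabiliser `D_A = MulAction.stabilizer Γ A`).  Cochains are explicit:
`f : Γ → Γ → R` read on a subgroup `S` ("locally constant on `S`", "cocycle on `S`", "coboundary on
`S` of a cochain locally constant on `S`"), as in `NeukirchAbstractUniqueness.lean`.  For a number field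
`K ⊆ Ω` (an `IntermediateField ℚ Ω` with `[NumberField K]`), abc-iut-w6-d055's
`NeukirchUchidaProof.galTransport K : Gal(\bar K/K) ≃ₜ* Γ_K ≤ Γ` identifies the abstract absolute Galois
group of `K` with the open subgroup `Γ_K`.  This file is the bookkeeping for moving the hypotheses of
Neukirch's lemma between the two sides:

* `coboundaryOn_of_coboundaryOn_corresponding` / `coboundaryOn_corresponding_of_coboundaryOn` —
  coboundaries on corresponding subgroups `T ≤ H`, `T' ≤ S` along any `e : H ≃ₜ* S`;
* `coboundaryOn_decompositionSubgroup_iff_of_mem_primesAbove` — for a cocycle on all of `Gal(\bar K/K)`,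
  "cobounding on `D_𝔔`" depends only on the place below `𝔔`;
* the DICTIONARY `exists_primesAbove_map_galTransport_eq` (down: `A ↦ (w, 𝔔)` with
  `galTransport (D_𝔔) = D_A ∩ Γ_K` and `w` below `A`) and `exists_ne_top_map_galTransport_eq` (up:
  `w ↦ A` with `galTransport (D_{𝔓₀(w)}) = D_A ∩ Γ_K`), assembled from the tree's
  `exists_ideal_mem_primesAbove_of_ne_top`, `decompositionGroupNF_eq_decompositionSubgroup`,
  `exists_valuationSubring_decompositionGroupNF_eq` and `map_stabilizer_comap_galTransport`;
* `exists_mem_ΓK_smul_eq_of_primesAbove` — primes of `Ω` whose `K`-places agree are `Γ_K`-conjugate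
  ([NSW] (12.1.3) in the tree's form `eq_of_decompositionGroupNF_eq`).

## References

* J. Neukirch, A. Schmidt, K. Wingberg, *Cohomology of Number Fields* (2nd ed. 2008), XII §1,
  (12.1.3), (12.1.9), (12.2.1). [NeukirchSchmidtWingberg2008]
* J. Neukirch, *Kennzeichnung der p-adischen und der endlichen algebraischen Zahlkörper*,
  Invent. Math. 6 (1969) 296–314, §2. [Neukirch1969]
* J.-P. Serre, *Galois Cohomology* (1997), I §2.2 (explicit cochains). [SerreGaloisCohomology1997]
* J.-P. Serre, *Local Fields* (1979), Ch. I §7. [SerreLocalFields1979]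
-/

noncomputable section

open Function Field IsDedekindDomain NumberField IntermediateField
open scoped Pointwise

/-! ### Transport of coboundaries between corresponding subgroups along `e : H ≃ₜ* S` -/

namespace Literature.GroupTheory.LocallyConstantCocycles

universe u v w

variable {H : Type u} [Group H] [TopologicalSpace H]
variable {Γ : Type v} [Group Γ] [TopologicalSpace Γ]
variable {R : Type w} [AddCommGroup R]

/-- **Coboundaries descend along `e : H ≃ₜ* S` to corresponding subgroups.**  If `f` restricts to `d`
through `e`, `T' ≤ S` corresponds to `T ≤ H` (`e x ∈ T' ↔ x ∈ T`) and `f` is the coboundary on `T'` of a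
cochain locally constant on `T'`, then `d` is the coboundary on `T` of a cochain locally constant on `T`.
[cite: SerreGaloisCohomology1997, I §2.2] -/
theorem coboundaryOn_of_coboundaryOn_corresponding (S : Subgroup Γ) (e : H ≃ₜ* S) {d : H → H → R}
    {f : Γ → Γ → R} (hfe : ∀ a b : H, f (e a) (e b) = d a b) {T : Subgroup H} {T' : Subgroup Γ}
    (hTT' : ∀ x : H, ((e x : S) : Γ) ∈ T' ↔ x ∈ T)
    (h : ∃ β : Γ → R, IsLocallyConstant (fun s : T' => β s) ∧
      ∀ a ∈ T', ∀ b ∈ T', f a b = β a + β b - β (a * b)) :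
    ∃ β' : H → R, IsLocallyConstant (fun t : T => β' t) ∧
      ∀ a ∈ T, ∀ b ∈ T, d a b = β' a + β' b - β' (a * b) := by
  obtain ⟨β, hβ, hcob⟩ := h
  refine ⟨fun x => β (e x), ?_, fun a ha b hb => ?_⟩
  · have heq : (fun t : T => β (e (t : H))) =
        (fun s : T' => β s) ∘ fun t : T => ⟨((e (t : H) : S) : Γ), (hTT' t).mpr t.2⟩ := by
      funext t; rfl
    rw [heq]
    exact hβ.comp_continuous
      ((continuous_subtype_val.comp (e.continuous.comp continuous_subtype_val)).subtype_mk _)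
  · have hab : ((e a : S) : Γ) * (e b : S) = (e (a * b) : S) := by rw [map_mul, Subgroup.coe_mul]
    rw [← hfe, hcob _ ((hTT' a).mpr ha) _ ((hTT' b).mpr hb), hab]

/-- **Coboundaries ascend along `e : H ≃ₜ* S` to corresponding subgroups.**  In the situation of
`coboundaryOn_of_coboundaryOn_corresponding`, if `d` is the coboundary on `T` of a cochain locally
constant on `T`, then `f` is the coboundary on `T'` of a cochain locally constant on `T'`.
[cite: SerreGaloisCohomology1997, I §2.2] -/
theorem coboundaryOn_corresponding_of_coboundaryOn (S : Subgroup Γ) (e : H ≃ₜ* S) {d : H → H → R}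
    {f : Γ → Γ → R} (hfe : ∀ a b : H, f (e a) (e b) = d a b) {T : Subgroup H} {T' : Subgroup Γ}
    (hT'S : T' ≤ S) (hTT' : ∀ x : H, ((e x : S) : Γ) ∈ T' ↔ x ∈ T)
    (h : ∃ β' : H → R, IsLocallyConstant (fun t : T => β' t) ∧
      ∀ a ∈ T, ∀ b ∈ T, d a b = β' a + β' b - β' (a * b)) :
    ∃ β : Γ → R, IsLocallyConstant (fun s : T' => β s) ∧
      ∀ a ∈ T', ∀ b ∈ T', f a b = β a + β b - β (a * b) := by
  classical
  obtain ⟨β', hβ', hcob⟩ := h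
  let β : Γ → R := fun x => if hx : x ∈ S then β' (e.symm ⟨x, hx⟩) else 0
  have hβ : ∀ x : S, β x = β' (e.symm x) := fun x => by simp only [β, dif_pos x.2]
  have hmemT : ∀ s : T', e.symm ⟨(s : Γ), hT'S s.2⟩ ∈ T := fun s =>
    (hTT' _).mp (by rw [ContinuousMulEquiv.apply_symm_apply]; exact s.2)
  refine ⟨β, ?_, fun a ha b hb => ?_⟩
  · have heq : (fun s : T' => β s) =
        (fun t : T => β' t) ∘ fun s : T' => ⟨e.symm ⟨(s : Γ), hT'S s.2⟩, hmemT s⟩ := by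
      funext s
      exact hβ ⟨s, hT'S s.2⟩
    rw [heq]
    exact hβ'.comp_continuous
      ((e.symm.continuous.comp (continuous_subtype_val.subtype_mk _)).subtype_mk _)
  · obtain ⟨a', ha', rfl⟩ : ∃ a' : H, a' ∈ T ∧ ((e a' : S) : Γ) = a :=
      ⟨e.symm ⟨a, hT'S ha⟩, hmemT ⟨a, ha⟩, by simp⟩
    obtain ⟨b', hb', rfl⟩ : ∃ b' : H, b' ∈ T ∧ ((e b' : S) : Γ) = b :=
      ⟨e.symm ⟨b, hT'S hb⟩, hmemT ⟨b, hb⟩, by simp⟩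
    have hab : ((e a' : S) : Γ) * (e b' : S) = (e (a' * b') : S) := by
      rw [map_mul, Subgroup.coe_mul]
    rw [hab, hfe, hβ, hβ, hβ, e.symm_apply_apply, e.symm_apply_apply, e.symm_apply_apply]
    exact hcob a' ha' b' hb'

end Literature.GroupTheory.LocallyConstantCocycles

namespace Literature.NumberTheory.GaloisRepresentations.ExplicitMuCocycles

open Literature.NumberTheory.GaloisRepresentations Literature.AnabelianGeometry.AbsoluteAnabelian
open Literature.AnabelianGeometry.AbsoluteAnabelian.NeukirchUchidaProof
open Literature.GroupTheory.LocallyConstantCocycles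

/-! ### Conjugation invariance of "cobounding on `D_𝔔`" among the primes above one place -/

/-- For a locally constant `2`-cocycle `f` on all of `Gal(\bar K/K)` and two primes `𝔔, 𝔔'` of `\bar ℤ_K`
above the same place `w`, `f` cobounds on `D_𝔔` iff it cobounds on `D_{𝔔'}` (the primes are conjugate,
`D_{σ𝔔} = σ D_𝔔 σ⁻¹`, and conjugation acts trivially on `H²(Gal(\bar K/K), ℤ/ℓ)`).
[cite: NeukirchSchmidtWingberg2008, XII §1 (12.1.9)] -/
theorem coboundaryOn_decompositionSubgroup_iff_of_mem_primesAbove (K : Type) [Field K] [NumberField K]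
    {ℓ : ℕ} (hℓ : ℓ.Prime) {w : HeightOneSpectrum (𝓞 K)} {𝔔 𝔔' : Ideal (absIntegers (𝓞 K) K)}
    (h𝔔 : 𝔔 ∈ w.primesAbove) (h𝔔' : 𝔔' ∈ w.primesAbove)
    (f : absoluteGaloisGroup K → absoluteGaloisGroup K → ZMod ℓ) (hlc : IsLocallyConstant (uncurry f))
    (hcoc : ∀ σ τ υ, f σ τ + f (σ * τ) υ = f τ υ + f σ (τ * υ)) :
    (∃ β : absoluteGaloisGroup K → ZMod ℓ,
        IsLocallyConstant (fun s : ↥(𝔔.decompositionSubgroup (absoluteGaloisGroup K)) => β s) ∧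
        ∀ a ∈ 𝔔.decompositionSubgroup (absoluteGaloisGroup K),
          ∀ b ∈ 𝔔.decompositionSubgroup (absoluteGaloisGroup K), f a b = β a + β b - β (a * b)) ↔
    (∃ β : absoluteGaloisGroup K → ZMod ℓ,
        IsLocallyConstant (fun s : ↥(𝔔'.decompositionSubgroup (absoluteGaloisGroup K)) => β s) ∧
        ∀ a ∈ 𝔔'.decompositionSubgroup (absoluteGaloisGroup K),
          ∀ b ∈ 𝔔'.decompositionSubgroup (absoluteGaloisGroup K), f a b = β a + β b - β (a * b)) := by
  haveI : Fact ℓ.Prime := ⟨hℓ⟩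
  obtain ⟨σ, rfl⟩ := HeightOneSpectrum.exists_smul_eq_of_mem_primesAbove_holds h𝔔 h𝔔'
  have hlc' : IsLocallyConstant
      (fun q : (⊤ : Subgroup (absoluteGaloisGroup K)) × (⊤ : Subgroup (absoluteGaloisGroup K)) =>
        f q.1 q.2) :=
    haveI hc : Continuous (fun q : (⊤ : Subgroup (absoluteGaloisGroup K)) ×
        (⊤ : Subgroup (absoluteGaloisGroup K)) =>
        ((q.1 : absoluteGaloisGroup K), (q.2 : absoluteGaloisGroup K))) :=
      (continuous_subtype_val.comp continuous_fst).prodMk (continuous_subtype_val.comp continuous_snd)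
    hlc.comp_continuous hc
  have hcoc' : ∀ a ∈ (⊤ : Subgroup (absoluteGaloisGroup K)), ∀ b ∈ (⊤ : Subgroup (absoluteGaloisGroup K)),
      ∀ c ∈ (⊤ : Subgroup (absoluteGaloisGroup K)), f a b + f (a * b) c = f b c + f a (b * c) :=
    fun a _ b _ c _ => hcoc a b c
  have key := NeukirchAbstract.coboundary_stabilizer_smul_iff (P := Ideal (absIntegers (𝓞 K) K))
    (V := ⊤) (V₁ := ⊤) le_rfl hlc' hcoc' (Subgroup.mem_top σ) 𝔔
  -- `D_𝔔 = stabilizer 𝔔` (an `abbrev`) and `S ⊓ ⊤` versus `S`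
  constructor
  · intro h
    exact coboundary_mono (S := MulAction.stabilizer _ (σ • 𝔔) ⊓ ⊤) (T := MulAction.stabilizer _ (σ • 𝔔))
      (le_inf le_rfl le_top)
      (key.mpr (coboundary_mono (S := MulAction.stabilizer _ 𝔔) (T := MulAction.stabilizer _ 𝔔 ⊓ ⊤)
        inf_le_left h))
  · intro h
    exact coboundary_mono (S := MulAction.stabilizer _ 𝔔 ⊓ ⊤) (T := MulAction.stabilizer _ 𝔔)
      (le_inf le_rfl le_top)
      (key.mp (coboundary_mono (S := MulAction.stabilizer _ (σ • 𝔔))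
        (T := MulAction.stabilizer _ (σ • 𝔔) ⊓ ⊤) inf_le_left h))

/-! ### Base change to a number field `K ⊆ Ω`: the dictionary `D_A ∩ Γ_K ↔ D_𝔔` -/

section BaseChange

variable (K : IntermediateField ℚ (AlgebraicClosure ℚ)) [NumberField K]

/-- Non-units of a valuation subring: `y ∈ 𝔪_B ↔ y = 0 ∨ y⁻¹ ∉ B`.
[cite: SerreLocalFields1979, Ch. I §7 Prop. 19–21] -/
private theorem mem_nonunits_iff_eq_zero_or_inv_notMem {M : Type*} [Field M] (B : ValuationSubring M)
    (y : M) : y ∈ B.nonunits ↔ y = 0 ∨ y⁻¹ ∉ B := by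
  rw [ValuationSubring.mem_nonunits_iff]
  by_cases hy : y = 0
  · simp [hy]
  · rw [← B.valuation_le_one_iff, map_inv₀, inv_le_one₀ ((Valuation.pos_iff _).mpr hy), not_le]
    simp [hy]

/-- Non-units of a pulled-back valuation subring: `x ∈ 𝔪_{A.comap φ} ↔ φ x ∈ 𝔪_A`.
[cite: SerreLocalFields1979, Ch. I §7 Prop. 19–21] -/
private theorem mem_nonunits_comap_iff {L L' : Type*} [Field L] [Field L'] (A : ValuationSubring L')
    (φ : L →+* L') (x : L) : x ∈ (A.comap φ).nonunits ↔ φ x ∈ A.nonunits := by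
  rw [mem_nonunits_iff_eq_zero_or_inv_notMem, mem_nonunits_iff_eq_zero_or_inv_notMem,
    ValuationSubring.mem_comap, map_inv₀, map_eq_zero]

/-- From `T.map galTransport = D.subgroupOf Γ_K`: `galTransport x ∈ D ∩ Γ_K ↔ x ∈ T`.
[cite: NeukirchSchmidtWingberg2008, Thm (12.2.1)] -/
private theorem galTransport_mem_inf_iff {T : Subgroup (absoluteGaloisGroup K)}
    {D : Subgroup (absoluteGaloisGroup ℚ)}
    (h : T.map (galTransport K).toMonoidHom = D.subgroupOf (ΓK K)) (x : absoluteGaloisGroup K) :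
    ((galTransport K x : ΓK K) : absoluteGaloisGroup ℚ) ∈ D ⊓ ΓK K ↔ x ∈ T := by
  rw [Subgroup.mem_inf, and_iff_left (galTransport K x).2, ← Subgroup.mem_subgroupOf, ← h,
    ← Subgroup.mem_map_iff_mem (f := (galTransport K).toMonoidHom) (galTransport K).injective]
  rfl

/-- Pull-back of a cochain on `Γ_K ≤ Γ` to the abstract group `Gal(\bar K/K)` along `galTransport`:
locally constant and a cocycle on the whole group. [cite: SerreGaloisCohomology1997, I §2.2] -/
private theorem exists_pullback_galTransport {R : Type*} [AddCommGroup R]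
    (f : absoluteGaloisGroup ℚ → absoluteGaloisGroup ℚ → R)
    (hlc : IsLocallyConstant (fun q : ΓK K × ΓK K => f q.1 q.2))
    (hcoc : ∀ a ∈ ΓK K, ∀ b ∈ ΓK K, ∀ c ∈ ΓK K, f a b + f (a * b) c = f b c + f a (b * c)) :
    ∃ d : absoluteGaloisGroup K → absoluteGaloisGroup K → R, IsLocallyConstant (uncurry d) ∧
      (∀ a b c, d a b + d (a * b) c = d b c + d a (b * c)) ∧
      ∀ a b, f (galTransport K a) (galTransport K b) = d a b := by
  refine ⟨fun a b => f (galTransport K a) (galTransport K b), ?_, ?_, fun _ _ => rfl⟩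
  · have heq : (uncurry fun a b => f (galTransport K a) (galTransport K b)) =
        (fun q : ΓK K × ΓK K => f q.1 q.2) ∘
          fun x : absoluteGaloisGroup K × absoluteGaloisGroup K =>
            (galTransport K x.1, galTransport K x.2) := by
      funext x; rfl
    rw [heq]
    exact hlc.comp_continuous (((galTransport K).continuous.comp continuous_fst).prodMk
      ((galTransport K).continuous.comp continuous_snd))
  · intro a b c
    have hab : ((galTransport K a : ΓK K) : absoluteGaloisGroup ℚ) * (galTransport K b : ΓK K) =
        (galTransport K (a * b) : ΓK K) := by rw [map_mul, Subgroup.coe_mul]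
    have hbc : ((galTransport K b : ΓK K) : absoluteGaloisGroup ℚ) * (galTransport K c : ΓK K) =
        (galTransport K (b * c) : ΓK K) := by rw [map_mul, Subgroup.coe_mul]
    have := hcoc _ (galTransport K a).2 _ (galTransport K b).2 _ (galTransport K c).2
    rw [hab, hbc] at this
    exact this

/-- **Dictionary, downwards.**  For a nonarchimedean prime `A ≠ ⊤` of `Ω` there are a place `w` of `K`
and a prime `𝔔 ∣ w` of `\bar ℤ_K` whose decomposition group `D_𝔔 ≤ Gal(\bar K/K)` is carried by
`galTransport` onto `D_A ∩ Γ_K`, and `w` lies below `A`: an integer `n` is a non-unit of `A` iff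
`n ∈ 𝔭_w`. [cite: NeukirchSchmidtWingberg2008, XII §1 (12.1.9)] -/
theorem exists_primesAbove_map_galTransport_eq (A : ValuationSubring (AlgebraicClosure ℚ))
    (hA : A ≠ ⊤) :
    ∃ (w : HeightOneSpectrum (𝓞 K)) (𝔔 : Ideal (absIntegers (𝓞 K) K)), 𝔔 ∈ w.primesAbove ∧
      (𝔔.decompositionSubgroup (absoluteGaloisGroup K)).map (galTransport K).toMonoidHom =
        (MulAction.stabilizer (absoluteGaloisGroup ℚ) A).subgroupOf (ΓK K) ∧
      ∀ n : ℤ, (n : AlgebraicClosure ℚ) ∈ A.nonunits ↔ (n : 𝓞 K) ∈ w.asIdeal := by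
  have hB : A.comap (closureEquiv K : AlgebraicClosure K →+* AlgebraicClosure ℚ) ≠ ⊤ :=
    (comap_closureEquiv_ne_top_iff K A).mpr hA
  obtain ⟨w, 𝔔, h𝔔w, hdic⟩ := exists_ideal_mem_primesAbove_of_ne_top _ hB
  refine ⟨w, 𝔔, h𝔔w, ?_, fun n => ?_⟩
  · rw [← decompositionGroupNF_eq_decompositionSubgroup _ 𝔔 hdic,
      map_decompositionGroupNF_comap_galTransport K A, decompositionGroupNF_eq_stabilizer]
  · haveI := h𝔔w.2
    have h1 : (n : 𝓞 K) ∈ w.asIdeal ↔ ((n : absIntegers (𝓞 K) K)) ∈ 𝔔 := by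
      rw [Ideal.LiesOver.over (P := 𝔔) (p := w.asIdeal), Ideal.under_def, Ideal.mem_comap, map_intCast]
    rw [h1, hdic, mem_nonunits_comap_iff]
    simp

/-- **Dictionary, upwards.**  For a place `w` of `K` the decomposition group `D_{𝔓₀(w)}` of the
distinguished prime `𝔓₀(w) = adicCompletionPrime K w` is carried by `galTransport` onto `D_A ∩ Γ_K` for
some nonarchimedean prime `A ≠ ⊤` of `Ω`. [cite: NeukirchSchmidtWingberg2008, XII §1 (12.1.9)] -/
theorem exists_ne_top_map_galTransport_eq (w : HeightOneSpectrum (𝓞 K)) :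
    ∃ A : ValuationSubring (AlgebraicClosure ℚ), A ≠ ⊤ ∧
      ((adicCompletionPrime K w).decompositionSubgroup (absoluteGaloisGroup K)).map
          (galTransport K).toMonoidHom =
        (MulAction.stabilizer (absoluteGaloisGroup ℚ) A).subgroupOf (ΓK K) := by
  obtain ⟨B, hB, -, hD⟩ :=
    exists_valuationSubring_decompositionGroupNF_eq K (adicCompletionPrime_mem_primesAbove K w)
  set A : ValuationSubring (AlgebraicClosure ℚ) :=
    B.comap ((closureEquiv K).symm : AlgebraicClosure ℚ →+* AlgebraicClosure K) with hAdef
  have hAB : A.comap (closureEquiv K : AlgebraicClosure K →+* AlgebraicClosure ℚ) = B := by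
    ext y
    rw [ValuationSubring.mem_comap, hAdef, ValuationSubring.mem_comap]
    change (closureEquiv K).symm (closureEquiv K y) ∈ B ↔ y ∈ B
    rw [AlgEquiv.symm_apply_apply]
  refine ⟨A, ?_, ?_⟩
  · rw [← comap_closureEquiv_ne_top_iff K A, hAB]
    exact hB
  · rw [← map_stabilizer_comap_galTransport K A, hAB, ← decompositionGroupNF_eq_stabilizer, hD]

/-- The decomposition group over `K` determines the prime: if `D_{𝔔₁} ↦ D_{A₁} ∩ Γ_K`,
`D_{𝔔₂} ↦ D_{A₂} ∩ Γ_K` under `galTransport` and `𝔔₁, 𝔔₂` lie over the same place of `K`, then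
`A₂ = g • A₁` for some `g ∈ Γ_K` ([NSW] (12.1.3): `D_A ≤ D_B ⇒ A = B`, tree
`eq_of_decompositionGroupNF_eq`). [cite: NeukirchSchmidtWingberg2008, XII §1 (12.1.9)] -/
theorem exists_mem_ΓK_smul_eq_of_primesAbove {A₁ A₂ : ValuationSubring (AlgebraicClosure ℚ)}
    (hA₁ : A₁ ≠ ⊤) (hA₂ : A₂ ≠ ⊤) {w : HeightOneSpectrum (𝓞 K)} {𝔔₁ 𝔔₂ : Ideal (absIntegers (𝓞 K) K)}
    (h𝔔₁ : 𝔔₁ ∈ w.primesAbove) (h𝔔₂ : 𝔔₂ ∈ w.primesAbove)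
    (hmap₁ : (𝔔₁.decompositionSubgroup (absoluteGaloisGroup K)).map (galTransport K).toMonoidHom =
      (MulAction.stabilizer (absoluteGaloisGroup ℚ) A₁).subgroupOf (ΓK K))
    (hmap₂ : (𝔔₂.decompositionSubgroup (absoluteGaloisGroup K)).map (galTransport K).toMonoidHom =
      (MulAction.stabilizer (absoluteGaloisGroup ℚ) A₂).subgroupOf (ΓK K)) :
    ∃ g ∈ ΓK K, g • A₁ = A₂ := by
  obtain ⟨σ, hσ⟩ := HeightOneSpectrum.exists_smul_eq_of_mem_primesAbove_holds h𝔔₁ h𝔔₂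
  set e := closureEquiv K with he
  set g : absoluteGaloisGroup ℚ := ((galTransport K σ : ΓK K) : absoluteGaloisGroup ℚ) with hg
  refine ⟨g, (galTransport K σ).2, ?_⟩
  -- the pulled-back valuation subrings have the same stabiliser in `Gal(\bar K/K)`
  have hB₁ : A₁.comap (e : AlgebraicClosure K →+* AlgebraicClosure ℚ) ≠ ⊤ :=
    (comap_closureEquiv_ne_top_iff K A₁).mpr hA₁
  have hB₂ : A₂.comap (e : AlgebraicClosure K →+* AlgebraicClosure ℚ) ≠ ⊤ :=
    (comap_closureEquiv_ne_top_iff K A₂).mpr hA₂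
  have hinj : Function.Injective (Subgroup.map (galTransport K).toMonoidHom) :=
    Subgroup.map_injective (galTransport K).injective
  have hst₁ : MulAction.stabilizer (absoluteGaloisGroup K)
      (A₁.comap (e : AlgebraicClosure K →+* AlgebraicClosure ℚ)) =
        𝔔₁.decompositionSubgroup (absoluteGaloisGroup K) :=
    hinj ((map_stabilizer_comap_galTransport K A₁).trans hmap₁.symm)
  have hst₂ : MulAction.stabilizer (absoluteGaloisGroup K)
      (A₂.comap (e : AlgebraicClosure K →+* AlgebraicClosure ℚ)) =
        𝔔₂.decompositionSubgroup (absoluteGaloisGroup K) :=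
    hinj ((map_stabilizer_comap_galTransport K A₂).trans hmap₂.symm)
  -- hence `σ • B₁` and `B₂` have the same stabiliser, so they are equal
  have hσB : MulAction.stabilizer (absoluteGaloisGroup K)
      (σ • A₁.comap (e : AlgebraicClosure K →+* AlgebraicClosure ℚ)) =
        MulAction.stabilizer (absoluteGaloisGroup K)
          (A₂.comap (e : AlgebraicClosure K →+* AlgebraicClosure ℚ)) := by
    rw [MulAction.stabilizer_smul_eq_stabilizer_map_conj, hst₁, hst₂, ← hσ,
      Ideal.decompositionSubgroup_smul]
    rfl
  have hσB₁ : σ • A₁.comap (e : AlgebraicClosure K →+* AlgebraicClosure ℚ) ≠ ⊤ := by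
    intro htop
    apply hB₁
    rw [eq_top_iff]
    intro x _
    have hx : σ • x ∈ σ • A₁.comap (e : AlgebraicClosure K →+* AlgebraicClosure ℚ) := by
      rw [htop]; trivial
    exact ValuationSubring.smul_mem_pointwise_smul_iff.mp hx
  have hBeq : σ • A₁.comap (e : AlgebraicClosure K →+* AlgebraicClosure ℚ) =
      A₂.comap (e : AlgebraicClosure K →+* AlgebraicClosure ℚ) := by
    refine eq_of_decompositionGroupNF_eq _ _ hσB₁ hB₂ ?_
    rw [decompositionGroupNF_eq_stabilizer, decompositionGroupNF_eq_stabilizer, hσB]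
  -- read back in `Ω` through `e`
  ext x
  have h2 : (e.symm x) ∈ A₂.comap (e : AlgebraicClosure K →+* AlgebraicClosure ℚ) ↔ x ∈ A₂ := by
    rw [ValuationSubring.mem_comap]
    change e (e.symm x) ∈ A₂ ↔ x ∈ A₂
    rw [AlgEquiv.apply_symm_apply]
  rw [← h2, ← hBeq, ValuationSubring.mem_pointwise_smul_iff_inv_smul_mem,
    ValuationSubring.mem_pointwise_smul_iff_inv_smul_mem, ValuationSubring.mem_comap]
  change g⁻¹ • x ∈ A₁ ↔ e (σ⁻¹ • e.symm x) ∈ A₁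
  rw [hg, ← Subgroup.coe_inv, ← map_inv, galTransport_smul]

end BaseChange

end Literature.NumberTheory.GaloisRepresentations.ExplicitMuCocycles

end

-- tree-health (abc-iut-w6-d081 g4, 2026-08-26T16:17Z): comment-only re-land of a STRANDED ACCEPT (accepted 15:13–15:14Z, farm import probe hangs «stale:unbuilt» at 16:0xZ, ≥ 50 min);
-- declarations byte-identical; rule of record: a re-land outside a reload window is served in 10–27 min (13/13 on 2026-08-26).
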